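import Mathlib
import HarnessLib
import Summits.HubbardSuperconductivity.HubbardSuperconductivity.Theorems.KLProgrammeH10TwoPointLimitPerturbedCountCooper
import Summits.HubbardSuperconductivity.HubbardSuperconductivity.Theorems.KLProgrammeH10TwoPointLimitPerturbedFermiRadiusAccelBand

/-!
# Route `KLProgramme` — crux K1 `H10TwoPointLimit` (stmt-HubbardSuperconductivity-19938):
# the stratified diagonal bound ON THE PERTURBED CURVE (the tree's `diag_strat` on the moving curve)

Fifth (S)-lemma of the port HOME/prover-p4/PORT-NOTE.md (architecture (β)). For a root selection `u` of the perturbed curve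
`{ε₀ + δ = μ}` (`δ ∈ C²`, `|δ| ≤ κ₀`, `‖Dδ‖ ≤ κ₁ < Dt_min`, `‖D(Dδ)‖ ≤ κ₂` on all of `ℝ²`): `diag_strat_perturbed` — the lineage's
`diag_strat_offset` on the moving curve: for reals `S_x, S_y` with `|ε₂(S_x,S_y) - μ'| ≤ η₀` and level gaps `|μ' - ν(θ)| ≤ 2κ₀`, if the
perturbed diagonal first derivative `2(2 sin S_x X_E'(σ) + 2 sin S_y Y_E'(σ) + Dδ(S)[p_E'(σ)])` is `≤ η₁` in modulus then the perturbed
diagonal second derivative `8(cos S_x X_E'² + cos S_y Y_E'²) + 4(sin S_x X_E'' + sin S_y Y_E'') + 4D²δ(S)[p_E', p_E'] + 2Dδ(S)[p_E'']`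
is `≥ 2h_min`, at the price of an explicit `O(κ₀ + κ₁ + κ₂ + η₀ + η₁)` loss absorbed by the smallness hypothesis (expanded constants
`C_V, S_E, U₁, U₂, A_E` as in `…PerturbedCountCooper.lean` / `…PerturbedCountFold.lean`). Proof = the lineage's, step for step:
alignment `exists_int_near_of_h3E_small`, sign/cos alignment at the shifted level, `hess_perturbed_ge` (the `h_min` field of the
moving curve) and `sin_mul_accel_eq` (the fold identity with its `D²δ`/`Dδ` correction). Everything is PROVED; no definitions.
References: BGM 2006 App. A2 [cite: BenfattoGiulianiMastropietro2006]; HOME/prover-p4/COUNTING-NOTE.md (the offset scheme).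
-/

noncomputable section

namespace Summit.HubbardSuperconductivity.HubbardSuperconductivity.Theorems.PerturbedFermiCurve

set_option linter.dupNamespace false -- summit = problem name (single-conjunct summit), D-0017

open Real Set
open Literature.MathematicalPhysics.QuantumLattice Literature.MathematicalPhysics.QuantumLattice.BandSectorCounting

section Diag

variable {a b : ℝ} (B : BandBounds a b) {δ : (Fin 2 → ℝ) → ℝ} (hδs : ContDiff ℝ 2 δ)
  {κ₀ κ₁ κ₂ μ : ℝ} (hδ : ∀ k : Fin 2 → ℝ, |δ k| ≤ κ₀) (hlo : a ≤ μ - κ₀) (hhi : μ + κ₀ ≤ b)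
  (hκ : ∀ k : Fin 2 → ℝ, ‖fderiv ℝ δ k‖ ≤ κ₁) (hκ₁ : κ₁ < B.Dtmin) (hκ₂ : ∀ k : Fin 2 → ℝ, ‖fderiv ℝ (fderiv ℝ δ) k‖ ≤ κ₂)
  {u : ℝ → ℝ} (hu : ∀ θ, IsBandFermiRadius (μ - δ (u θ • dir θ)) θ (u θ))
include B hδs hδ hlo hhi hκ hκ₁ hκ₂ hu

/-- **Stratified non-degeneracy of the diagonal function on the perturbed curve** (the tree's `diag_strat` / the lineage's
`diag_strat_offset` for the moving curve). For reals `S_x, S_y` with `|ε₂(S_x,S_y) - μ'| ≤ η₀`, `|μ' - ν(θ)| ≤ 2κ₀` for all shifted levels: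
if the perturbed diagonal first derivative `2(2 sin S_x X_E'(σ) + 2 sin S_y Y_E'(σ) + Dδ(S)[p_E'(σ)])` is `≤ η₁` in modulus, then the
perturbed diagonal second derivative (frozen trigonometric coefficients, `D²δ` and `Dδ` evaluated at `S`) is `≥ 2h_min`, under the
smallness `16C_V(S_E + s_max) + (16S_E² + 8A_E)ε₃ + 6κ₂S_E² + 4κ₁A_E ≤ 2h_min`, `ε₃ = η₀/Dt_min + 2κ₀/Dt_min + s_max C_g ε₄`,
`ε₄ = η₁/4 + κ₁S_E/2 + 2C_V + 2s_max η₀/Dt_min + 4s_max κ₀/Dt_min`. [cite: BenfattoGiulianiMastropietro2006, App. A2] -/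
theorem diag_strat_perturbed {Sx Sy μ' σ η₀ η₁ : ℝ} (hμ' : μ' ∈ Icc a b) (hlo' : a ≤ μ' - η₀) (hhi' : μ' + η₀ ≤ b)
    (hh' : |eps2 Sx Sy - μ'| ≤ η₀) (hgap : ∀ θ, |μ' - (μ - δ (u θ • dir θ))| ≤ 2 * κ₀) {S : Fin 2 → ℝ}
    (hH' : |2 * (2 * Real.sin Sx * VXE u σ + 2 * Real.sin Sy * VYE u σ + fderiv ℝ δ S ![VXE u σ, VYE u σ])| ≤ η₁)
    (hsmall :
      16 * (κ₁ * (π * Real.sqrt 2 + 2 * B.smax) / (B.Dtmin - κ₁)) * ((B.smax + κ₁ * (π * Real.sqrt 2 + 2 * B.smax) / (B.Dtmin - κ₁)) + B.smax) +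
        (16 * (B.smax + κ₁ * (π * Real.sqrt 2 + 2 * B.smax) / (B.Dtmin - κ₁)) ^ 2 + 8 * ((((4 + κ₂) * (B.smax + κ₁ * (π * Real.sqrt 2 + 2 * B.smax) / (B.Dtmin - κ₁)) ^ 2 + (8 + 2 * κ₁) * ((4 + κ₁) * (π * Real.sqrt 2) / (B.Dtmin - κ₁)) + (4 + κ₁) * (π * Real.sqrt 2)) / (B.Dtmin - κ₁)) + 2 * ((4 + κ₁) * (π * Real.sqrt 2) / (B.Dtmin - κ₁)) + π * Real.sqrt 2)) *
          (η₀ / B.Dtmin + 2 * κ₀ / B.Dtmin + B.smax * (B.Cg * (η₁ / 2 / 2 + κ₁ * (B.smax + κ₁ * (π * Real.sqrt 2 + 2 * B.smax) / (B.Dtmin - κ₁)) / 2 + 2 * (κ₁ * (π * Real.sqrt 2 + 2 * B.smax) / (B.Dtmin - κ₁)) + 2 * B.smax * (η₀ / B.Dtmin) + 2 * B.smax * (2 * κ₀ / B.Dtmin)))) +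
        6 * (κ₂ * (B.smax + κ₁ * (π * Real.sqrt 2 + 2 * B.smax) / (B.Dtmin - κ₁)) ^ 2) + 4 * (κ₁ * ((((4 + κ₂) * (B.smax + κ₁ * (π * Real.sqrt 2 + 2 * B.smax) / (B.Dtmin - κ₁)) ^ 2 + (8 + 2 * κ₁) * ((4 + κ₁) * (π * Real.sqrt 2) / (B.Dtmin - κ₁)) + (4 + κ₁) * (π * Real.sqrt 2)) / (B.Dtmin - κ₁)) + 2 * ((4 + κ₁) * (π * Real.sqrt 2) / (B.Dtmin - κ₁)) + π * Real.sqrt 2)) ≤ 2 * B.hmin) :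
    2 * B.hmin ≤ 8 * (Real.cos Sx * VXE u σ ^ 2 + Real.cos Sy * VYE u σ ^ 2) +
      4 * (Real.sin Sx * (deriv (deriv u) σ * Real.cos σ - 2 * deriv u σ * Real.sin σ - u σ * Real.cos σ) +
        Real.sin Sy * (deriv (deriv u) σ * Real.sin σ + 2 * deriv u σ * Real.cos σ - u σ * Real.sin σ)) +
      (4 * fderiv ℝ (fderiv ℝ δ) S ![VXE u σ, VYE u σ] ![VXE u σ, VYE u σ] +
        2 * fderiv ℝ δ S ![(deriv (deriv u) σ * Real.cos σ - 2 * deriv u σ * Real.sin σ - u σ * Real.cos σ),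
          (deriv (deriv u) σ * Real.sin σ + 2 * deriv u σ * Real.cos σ - u σ * Real.sin σ)]) := by
  have h2ne : (2 : WithTop ℕ∞) ≠ 0 := by norm_num
  have hδ' : ∀ k : Fin 2 → ℝ, (∀ i, |k i| ≤ π) → |δ k| ≤ κ₀ := fun k _ => hδ k
  have hκ' : ∀ k : Fin 2 → ℝ, (∀ i, |k i| ≤ π) → ‖fderiv ℝ δ k‖ ≤ κ₁ := fun k _ => hκ k
  have hκ₂' : ∀ k : Fin 2 → ℝ, (∀ i, |k i| ≤ π) → ‖fderiv ℝ (fderiv ℝ δ) k‖ ≤ κ₂ := fun k _ => hκ₂ k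
  have hs := B.smax_pos; have hDt := B.Dtmin_pos; have hCg := B.Cg_pos; have hh := B.hmin_pos
  have hden : 0 < B.Dtmin - κ₁ := sub_pos.2 hκ₁
  have hκ₁0 : 0 ≤ κ₁ := (norm_nonneg _).trans (hκ S)
  have hκ₂0 : 0 ≤ κ₂ := (norm_nonneg (fderiv ℝ (fderiv ℝ δ) S)).trans (hκ₂ S)
  -- lemma instances carrying the constants (instantiated BEFORE abbreviating)
  obtain ⟨hvx, hvy⟩ := abs_VXE_le B hδs h2ne hδ' hlo hhi hκ' hκ₁ hu σ
  obtain ⟨hAXb, hAYb⟩ := abs_accel_le B hδs hδ hlo hhi hκ hκ₁ hκ₂ hu σ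
  have hhess := hess_perturbed_ge B hδs hδ' hlo hhi hκ' hκ₁ hu σ
  have hid := sin_mul_accel_eq B hδs hδ' hlo hhi hκ' hκ₁ hu σ
  set AX := deriv (deriv u) σ * Real.cos σ - 2 * deriv u σ * Real.sin σ - u σ * Real.cos σ with hAX
  set AY := deriv (deriv u) σ * Real.sin σ + 2 * deriv u σ * Real.cos σ - u σ * Real.sin σ with hAY
  -- constants (abbreviated, then made opaque)
  set CV := κ₁ * (π * Real.sqrt 2 + 2 * B.smax) / (B.Dtmin - κ₁) with hCV
  set SE := B.smax + CV with hSE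
  set U1 := (4 + κ₁) * (π * Real.sqrt 2) / (B.Dtmin - κ₁) with hU1
  set U2 := ((4 + κ₂) * SE ^ 2 + (8 + 2 * κ₁) * U1 + (4 + κ₁) * (π * Real.sqrt 2)) / (B.Dtmin - κ₁) with hU2
  set AE := U2 + 2 * U1 + π * Real.sqrt 2 with hAE
  set ε4 := η₁ / 2 / 2 + κ₁ * SE / 2 + 2 * CV + 2 * B.smax * (η₀ / B.Dtmin) + 2 * B.smax * (2 * κ₀ / B.Dtmin) with hε4
  set ε3 := η₀ / B.Dtmin + 2 * κ₀ / B.Dtmin + B.smax * (B.Cg * ε4) with hε3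
  clear_value ε3 ε4 AE U2 U1 SE CV
  have hSE0 : 0 ≤ SE := (abs_nonneg _).trans hvx
  have hAE0 : 0 ≤ AE := (abs_nonneg _).trans hAXb
  -- Step 1: the perturbed partial at `σ` is small; localisation; alignment of `σ` with `φ`
  have hmid : |2 * Real.sin Sx * VXE u σ + 2 * Real.sin Sy * VYE u σ + fderiv ℝ δ S ![VXE u σ, VYE u σ]| ≤ η₁ / 2 := by
    rw [abs_mul, abs_two] at hH'; linarith
  obtain ⟨φ, hsx, hsy, hcx, hcy⟩ := exists_near_curve_trig B hμ' hh' hlo' hhi'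
  obtain ⟨j, hj⟩ := exists_int_near_of_h3E_small B hδs h2ne hδ hlo hhi hκ hκ₁ hu hμ' hsx hsy σ (hgap σ) hmid
  rw [← hCV, ← hSE, ← hε4] at hj
  set νσ := μ - δ (u σ • dir σ) with hνσ
  have hνσmem : νσ ∈ Icc a b := shiftedLevel_mem_Icc (hu σ) hδ' hlo hhi
  obtain ⟨σ', hσ', ax, ay, bx, bY⟩ := exists_sign_align B hνσmem hj
  have hσabs : |σ'| = 1 := by rcases hσ' with rfl | rfl <;> norm_num
  obtain ⟨hXσ, hYσ⟩ := XE_eq_bandX_shifted B hδ' hlo hhi hu σ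
  have hradφ : |bandFermiRadius μ' φ - bandFermiRadius νσ φ| ≤ 2 * κ₀ / B.Dtmin :=
    (abs_bandFermiRadius_sub_le_of_level B hνσmem hμ' φ).trans (div_le_div_of_nonneg_right (hgap σ) hDt.le)
  have s2x : |Real.sin (bandX μ' φ) - Real.sin (bandX νσ φ)| ≤ 2 * κ₀ / B.Dtmin := by
    refine (Real.abs_sin_sub_sin_le _ _).trans ?_
    rw [bandX, bandX, ← sub_mul, abs_mul]
    exact (mul_le_of_le_one_right (abs_nonneg _) (Real.abs_cos_le_one φ)).trans hradφ
  have s2y : |Real.sin (bandY μ' φ) - Real.sin (bandY νσ φ)| ≤ 2 * κ₀ / B.Dtmin := by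
    refine (Real.abs_sin_sub_sin_le _ _).trans ?_
    rw [bandY, bandY, ← sub_mul, abs_mul]
    exact (mul_le_of_le_one_right (abs_nonneg _) (Real.abs_sin_le_one φ)).trans hradφ
  have c2x : |Real.cos (bandX μ' φ) - Real.cos (bandX νσ φ)| ≤ 2 * κ₀ / B.Dtmin := by
    refine (Real.abs_cos_sub_cos_le _ _).trans ?_
    rw [bandX, bandX, ← sub_mul, abs_mul]
    exact (mul_le_of_le_one_right (abs_nonneg _) (Real.abs_cos_le_one φ)).trans hradφ
  have c2y : |Real.cos (bandY μ' φ) - Real.cos (bandY νσ φ)| ≤ 2 * κ₀ / B.Dtmin := by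
    refine (Real.abs_cos_sub_cos_le _ _).trans ?_
    rw [bandY, bandY, ← sub_mul, abs_mul]
    exact (mul_le_of_le_one_right (abs_nonneg _) (Real.abs_sin_le_one φ)).trans hradφ
  have cx : |σ' * Real.sin Sx - Real.sin (XE u σ)| ≤ ε3 := by
    rw [hXσ]
    have e : σ' * Real.sin Sx - Real.sin (bandX νσ σ) =
        σ' * ((Real.sin Sx - Real.sin (bandX μ' φ)) + (Real.sin (bandX μ' φ) - Real.sin (bandX νσ φ))) +
          (σ' * Real.sin (bandX νσ φ) - Real.sin (bandX νσ σ)) := by ring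
    rw [e]
    refine (abs_add_le _ _).trans ?_
    rw [abs_mul, hσabs, one_mul]
    have := abs_add_le (Real.sin Sx - Real.sin (bandX μ' φ)) (Real.sin (bandX μ' φ) - Real.sin (bandX νσ φ))
    rw [hε3]; linarith
  have cy : |σ' * Real.sin Sy - Real.sin (YE u σ)| ≤ ε3 := by
    rw [hYσ]
    have e : σ' * Real.sin Sy - Real.sin (bandY νσ σ) =
        σ' * ((Real.sin Sy - Real.sin (bandY μ' φ)) + (Real.sin (bandY μ' φ) - Real.sin (bandY νσ φ))) +
          (σ' * Real.sin (bandY νσ φ) - Real.sin (bandY νσ σ)) := by ring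
    rw [e]
    refine (abs_add_le _ _).trans ?_
    rw [abs_mul, hσabs, one_mul]
    have := abs_add_le (Real.sin Sy - Real.sin (bandY μ' φ)) (Real.sin (bandY μ' φ) - Real.sin (bandY νσ φ))
    rw [hε3]; linarith
  have dx : |Real.cos Sx - Real.cos (XE u σ)| ≤ ε3 := by
    rw [hXσ]
    have e : Real.cos Sx - Real.cos (bandX νσ σ) =
        (Real.cos Sx - Real.cos (bandX μ' φ)) + (Real.cos (bandX μ' φ) - Real.cos (bandX νσ φ)) +
          (Real.cos (bandX νσ φ) - Real.cos (bandX νσ σ)) := by ring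
    rw [e]
    refine (abs_add_le _ _).trans ?_
    have := abs_add_le (Real.cos Sx - Real.cos (bandX μ' φ)) (Real.cos (bandX μ' φ) - Real.cos (bandX νσ φ))
    rw [hε3]; linarith
  have dy : |Real.cos Sy - Real.cos (YE u σ)| ≤ ε3 := by
    rw [hYσ]
    have e : Real.cos Sy - Real.cos (bandY νσ σ) =
        (Real.cos Sy - Real.cos (bandY μ' φ)) + (Real.cos (bandY μ' φ) - Real.cos (bandY νσ φ)) +
          (Real.cos (bandY νσ φ) - Real.cos (bandY νσ σ)) := by ring
    rw [e]
    refine (abs_add_le _ _).trans ?_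
    have := abs_add_le (Real.cos Sy - Real.cos (bandY μ' φ)) (Real.cos (bandY μ' φ) - Real.cos (bandY νσ φ))
    rw [hε3]; linarith
  have hε30 : 0 ≤ ε3 := (abs_nonneg _).trans cx
  -- Step 2: the curvature of the perturbed curve at `σ` and the `δ`-terms
  set Hs := Real.cos (XE u σ) * VXE u σ ^ 2 + Real.cos (YE u σ) * VYE u σ ^ 2 with hHs
  set Dσ := fderiv ℝ (fderiv ℝ δ) (u σ • dir σ) ![VXE u σ, VYE u σ] ![VXE u σ, VYE u σ] +
      fderiv ℝ δ (u σ • dir σ) ![AX, AY] with hDσ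
  have hid' : Real.sin (XE u σ) * AX + Real.sin (YE u σ) * AY = -Hs - Dσ / 2 := hid
  have hv : ‖(![VXE u σ, VYE u σ] : Fin 2 → ℝ)‖ ≤ SE := norm_vec2_le hSE0 hvx hvy
  have hD2 : ∀ k : Fin 2 → ℝ, |fderiv ℝ (fderiv ℝ δ) k ![VXE u σ, VYE u σ] ![VXE u σ, VYE u σ]| ≤ κ₂ * SE ^ 2 := by
    intro k
    refine (abs_fderiv_fderiv_le (hκ₂ k) ![VXE u σ, VYE u σ] ![VXE u σ, VYE u σ]).trans ?_
    rw [sq, mul_assoc]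
    exact mul_le_mul_of_nonneg_left (mul_le_mul hv hv (norm_nonneg _) hSE0) hκ₂0
  have hD1 : ∀ k : Fin 2 → ℝ, |fderiv ℝ δ k ![AX, AY]| ≤ κ₁ * AE := fun k => abs_fderiv_vec2_le (hκ k) hAE0 hAXb hAYb
  have hDσb : |Dσ| ≤ κ₂ * SE ^ 2 + κ₁ * AE := (abs_add_le _ _).trans (add_le_add (hD2 _) (hD1 _))
  have hDS : |4 * fderiv ℝ (fderiv ℝ δ) S ![VXE u σ, VYE u σ] ![VXE u σ, VYE u σ] + 2 * fderiv ℝ δ S ![AX, AY]| ≤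
      4 * (κ₂ * SE ^ 2) + 2 * (κ₁ * AE) := by
    refine (abs_add_le _ _).trans ?_
    rw [abs_mul, abs_mul, show |(4:ℝ)| = 4 by norm_num, abs_two]
    linarith [hD2 S, hD1 S]
  have t1 : 0 ≤ (16 * SE ^ 2 + 8 * AE) * ε3 := by positivity
  have t2 : 0 ≤ κ₂ * SE ^ 2 := by positivity
  have t3 : 0 ≤ κ₁ * AE := by positivity
  have hHs_pos : 0 < Hs := by linarith
  -- Step 3: the `cos` part
  have hsq1 : |VXE u σ ^ 2| ≤ SE ^ 2 := by rw [abs_pow, sq, sq]; exact mul_le_mul hvx hvx (abs_nonneg _) hSE0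
  have hsq2 : |VYE u σ ^ 2| ≤ SE ^ 2 := by rw [abs_pow, sq, sq]; exact mul_le_mul hvy hvy (abs_nonneg _) hSE0
  have R1 := abs_two_term_sub_le (Real.cos Sx) (Real.cos Sy) (Real.cos (XE u σ)) (Real.cos (YE u σ)) (VXE u σ ^ 2) (VYE u σ ^ 2)
  have bR1 : |Real.cos Sx - Real.cos (XE u σ)| * |VXE u σ ^ 2| ≤ ε3 * SE ^ 2 := mul_le_mul dx hsq1 (abs_nonneg _) hε30
  have bR2 : |Real.cos Sy - Real.cos (YE u σ)| * |VYE u σ ^ 2| ≤ ε3 * SE ^ 2 := mul_le_mul dy hsq2 (abs_nonneg _) hε30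
  have part1 : 8 * Hs - 16 * SE ^ 2 * ε3 ≤ 8 * (Real.cos Sx * VXE u σ ^ 2 + Real.cos Sy * VYE u σ ^ 2) := by
    have := (abs_le.1 (R1.trans (add_le_add bR1 bR2))).1
    rw [hHs]; linarith
  -- Step 4: the `sin` part
  have R2 := abs_two_term_sub_le (σ' * Real.sin Sx) (σ' * Real.sin Sy) (Real.sin (XE u σ)) (Real.sin (YE u σ)) AX AY
  have bR3 : |σ' * Real.sin Sx - Real.sin (XE u σ)| * |AX| ≤ ε3 * AE := mul_le_mul cx hAXb (abs_nonneg _) hε30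
  have bR4 : |σ' * Real.sin Sy - Real.sin (YE u σ)| * |AY| ≤ ε3 * AE := mul_le_mul cy hAYb (abs_nonneg _) hε30
  have part2 : -4 * Hs - 2 * |Dσ| - 8 * AE * ε3 ≤ 4 * (Real.sin Sx * AX + Real.sin Sy * AY) := by
    have hb := abs_le.1 (R2.trans (add_le_add bR3 bR4))
    rw [hid'] at hb
    have hDa := le_abs_self Dσ
    have hDn := neg_abs_le Dσ
    rcases hσ' with rfl | rfl
    · simp only [one_mul] at hb; linarith [hb.1, hb.2]
    · simp only [neg_mul] at hb; linarith [hb.1, hb.2]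
  -- Step 5: assemble
  have hDSlo := (abs_le.1 hDS).1
  linarith

end Diag

end Summit.HubbardSuperconductivity.HubbardSuperconductivity.Theorems.PerturbedFermiCurve

end
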